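import Literature.AnabelianGeometry.AbsoluteAnabelian.RelativeGrothendieckConjecture
import Literature.AnabelianGeometry.AbsoluteAnabelian.GaloisTheatersNonVacuity
import Literature.AnabelianGeometry.AbsoluteAnabelian.SubpadicExamples
import HarnessLib

/-!
# [pGC] Theorem A, hom form and isom form: the universal closures of the model-relative typings are
# FALSE (junk data), and jointly satisfiable (point data) — FACT-LIST rows F-1792, F-1795 (and F-1794)

S. Mochizuki, *The local pro-`p` anabelian geometry of curves*, Invent. Math. 138 (1999) [pGC],
Theorem A p. 3 (= Thm 16.5 p. 86 with the Remark following it) and its remark (3) p. 3 (the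
isomorphism form).  Proof-only companion to `RelativeGrothendieckConjecture.lean` (abc-iut-L4-t13),
where these are typed MODEL-RELATIVELY (cell ruling θ, shape (M)) as predicates on an abstract
`RelativeAnabelianDatum G` — an INTERFACE with no axioms ("a junk datum falsifies only its own
instance", loc. cit.):

* `RelativeAnabelianDatum.RelHomGC D` (FACT-LIST F-1792) — the conclusion of Thm A;
* `pGC.ThmA K D := IsSubpadic K → D.primes = univ → D.RelHomGC` (F-1794);
* `pGC.ThmA_isom K D := IsSubpadic K → D.primes = univ → D.RelIsomGC` (F-1795).

abc-iut cell, block F (fact-proving wave), plan header rule R1 (ii) (abc-iut-plan 2026-08-26T05:41:23Z):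
for a PARAMETRISED row whose universal closure is false, file the kernel refutation `not_forall_<decl>`
(the FACT-LIST render then marks the row «universal-closure REFUTED / schema; instance forms open or
model-witnessed») and record the instance forms.  This file records, sorry-free:

1. `RelativeAnabelianDatum.exists_homEmpty_witness` — over EVERY profinite `G`, the JUNK datum with one
   object (declared a hyperbolic curve), NO scheme morphisms (`Hom := PEmpty`), `Σ := univ`, and
   `Π_X := G ↠ G` the point extension: the identity outer homomorphism of the point is open and
   bijective but has no preimage, so BOTH `RelHomGC` and `RelIsomGC` FAIL;
2. `RelativeAnabelianDatum.not_forall_relHomGC` (F-1792), `pGC.not_forall_thmA` (F-1794),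
   `pGC.not_forall_thmA_isom` (F-1795) — the universal closures are false (for the `pGC` rows over the
   sub-`p`-adic field `ℚ_2`, `AbsTopIII.IsSubpadicFor.padic`);
3. `pGC.exists_datum_thmA_and_thmA_isom` — over EVERY base field `K`, the one-object POINT datum of
   `RelativeAnabelianDatum.exists_point` (abc-iut-w5-d058) satisfies `pGC.ThmA`, `pGC.ThmA_isom` and
   `Tpcs.Thm_4_12` (every prime) SIMULTANEOUSLY (DEGENERATE model witness: no hyperbolic curve has
   `Δ = 1`; joint satisfiability of the three named facts at one datum, nothing about curves).

The instance forms that ARE theorems of the tree are cited, not restated: `pGC.thmA_isom_of_thm_4_12`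
(`RelativeGCReductions`), `pGC.thmA_isom_of_thmA` and `RelativeAnabelianDatum.relIsomGC_of_relHomGC`
(`RelativeGCFunctoriality`, functorial data).  The INTENDED instance — the étale `π₁` of smooth varieties /
hyperbolic curves over a sub-`p`-adic field — is not constructible in the tree (FOUNDATIONS row 12 of the
abc-iut cell); there Thm A is Mochizuki's theorem (Faltings' `p`-adic Hodge theory) and stays a NAMED
FACT at that instance.  HONEST FRAMING: statements about the cell's own interface typing; nothing here
bears on [IUTchIII] Cor 3.12; refuting a universal closure over junk data is not a claim about [pGC].
-/

universe u

namespace Literature.AnabelianGeometry.AbsoluteAnabelian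

open AugmentedProfiniteGrp AbsTopIII

/-! ### The junk datum: no scheme morphisms over the point extension -/

namespace RelativeAnabelianDatum

/-- **Junk witness.**  Over every profinite `G` there is a relative anabelian datum with `Σ` = all
primes, all of whose objects are declared hyperbolic curves, for which BOTH the relative hom-GC and the
relative isom-GC FAIL: one object `X`, `Hom(X, X) := ∅`, `Π_X := (G ↠ G)` the point; the identity
`Π_X → Π_X` is an open (indeed bijective) homomorphism over `G`, so its outer class lies in
`Hom^{open}` and in `Isom`, but nothing maps to it.  (The typing is an axiom-free interface: this is a
statement about the interface, not about [pGC] Thm A.) [cite: MochizukiLocAn1999, Thm A p.3] -/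
theorem exists_homEmpty_witness (G : ProfiniteGrp.{u}) :
    ∃ D : RelativeAnabelianDatum G, D.primes = Set.univ ∧ (∀ X, D.IsHyperbolicCurve X) ∧
      ¬ D.RelHomGC ∧ ¬ D.RelIsomGC := by
  let A : AugmentedProfiniteGrp G :=
    { arith := G, aug := ContinuousMonoidHom.id G, aug_surjective := Function.surjective_id }
  let ι : A.HomOver A := ⟨ContinuousMonoidHom.id _, fun _ => rfl⟩
  have hopen : OuterHom.mk ι ∈ {c : A.OuterHom A | c.IsOpen} := by
    rw [Set.mem_setOf_eq, OuterHom.isOpen_mk, HomOver.IsOpenHom]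
    have : Set.range ι.toHom = Set.univ := Set.range_eq_univ.mpr Function.surjective_id
    rw [this]
    exact isOpen_univ
  have hiso : OuterHom.mk ι ∈ {c : A.OuterHom A | c.IsIso} := by
    rw [Set.mem_setOf_eq, OuterHom.isIso_mk]
    exact Function.bijective_id
  refine ⟨{ Obj := PUnit.{u + 1}, Hom := fun _ _ => PEmpty.{u + 1}, IsIso := fun _ => True,
            IsHyperbolicCurve := fun _ => True, primes := Set.univ, grp := fun _ => A,
            outerHom := fun f => f.elim }, rfl, fun _ => trivial, ?_, ?_⟩
  · intro h
    obtain ⟨f, -, -⟩ := (h PUnit.unit PUnit.unit trivial).surjOn hopen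
    exact f.elim
  · intro h
    obtain ⟨f, -, -⟩ := (h PUnit.unit PUnit.unit trivial trivial).surjOn hiso
    exact f.elim

/-- **FACT-LIST F-1792 — the universal closure of `RelativeAnabelianDatum.RelHomGC` is FALSE** (schema
row: the predicate holds at some data — `RelativeAnabelianDatum.exists_point` — and fails at others).
Witness: the junk datum of `exists_homEmpty_witness` over the trivial profinite group.
[cite: MochizukiLocAn1999, Thm A p.3] -/
theorem not_forall_relHomGC :
    ¬ ∀ (G : ProfiniteGrp.{u}) (D : RelativeAnabelianDatum G),
      Literature.AnabelianGeometry.AbsoluteAnabelian.RelativeAnabelianDatum.RelHomGC D := by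
  intro h
  obtain ⟨D, -, -, hD, -⟩ := exists_homEmpty_witness (ProfiniteGrp.of PUnit.{u + 1})
  exact hD (h _ D)

/-- The same for the relative isom-GC predicate (recorded for the `pGC.ThmA_isom` refutation below; the
row F-0259 itself is abc-iut-f-105's). [cite: MochizukiTopics2003, Thm 4.12 p.44] -/
theorem exists_not_relIsomGC (G : ProfiniteGrp.{u}) :
    ∃ D : RelativeAnabelianDatum G, D.primes = Set.univ ∧ ¬ D.RelIsomGC := by
  obtain ⟨D, hS, -, -, hD⟩ := exists_homEmpty_witness G
  exact ⟨D, hS, hD⟩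

end RelativeAnabelianDatum

/-! ### [pGC] Theorem A over `ℚ_2`: the universal closures of `pGC.ThmA`, `pGC.ThmA_isom` are false -/

/-- `ℚ_2` is sub-`p`-adic (for `p = 2`: the identity embedding; `AbsTopIII.IsSubpadicFor.padic`).
[cite: MochizukiLocAn1999, Def 15.4 (i) p.77] -/
theorem pGC.isSubpadic_padicTwo : IsSubpadic ℚ_[2] :=
  ⟨⟨2, inferInstance, IsSubpadicFor.padic 2⟩⟩

/-- **FACT-LIST F-1794 — the universal closure of `pGC.ThmA` is FALSE**: over the sub-`2`-adic field
`ℚ_2`, the junk datum (no scheme morphisms, point extensions `Π_X := Γ_{ℚ_2}`) has `Σ` = all primes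
and violates the relative hom-GC.  Schema row: Thm A is a fact only AT THE INTENDED INSTANCE (étale `π₁`),
which the tree does not construct. [cite: MochizukiLocAn1999, Thm A p.3] -/
theorem pGC.not_forall_thmA :
    ¬ ∀ (K : Type) [Field K] [CharZero K] (D : RelativeAnabelianDatum (absoluteGaloisGrp K)),
      Literature.AnabelianGeometry.AbsoluteAnabelian.pGC.ThmA K D := by
  intro h
  obtain ⟨D, hS, -, hD, -⟩ :=
    RelativeAnabelianDatum.exists_homEmpty_witness (absoluteGaloisGrp ℚ_[2])
  exact hD (h ℚ_[2] D pGC.isSubpadic_padicTwo hS)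

/-- **FACT-LIST F-1795 — the universal closure of `pGC.ThmA_isom` is FALSE**: over `ℚ_2`, the junk
datum has `Σ` = all primes and violates the relative isom-GC (the identity outer isomorphism of the point
has no preimage among the — absent — `K`-isomorphisms).  The row's CONDITIONAL producers stand:
`pGC.thmA_isom_of_thm_4_12` ([Tpcs] Thm 4.12 ⇒), `pGC.thmA_isom_of_thmA` (Thm A ⇒, functorial data).
[cite: MochizukiLocAn1999, Thm A p.3] -/
theorem pGC.not_forall_thmA_isom :
    ¬ ∀ (K : Type) [Field K] [CharZero K] (D : RelativeAnabelianDatum (absoluteGaloisGrp K)),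
      Literature.AnabelianGeometry.AbsoluteAnabelian.pGC.ThmA_isom K D := by
  intro h
  obtain ⟨D, hS, hD⟩ := RelativeAnabelianDatum.exists_not_relIsomGC (absoluteGaloisGrp ℚ_[2])
  exact hD (h ℚ_[2] D pGC.isSubpadic_padicTwo hS)

/-! ### Model witness: the three relative GC facts hold simultaneously at the point datum -/

/-- **Joint satisfiability (DEGENERATE model witness) of `pGC.ThmA`, `pGC.ThmA_isom`, `Tpcs.Thm_4_12`.**
Over every base field `K` of characteristic zero, the one-object point datum over `Γ_K`
(`RelativeAnabelianDatum.exists_point`: `Π_X := Γ_K`, `Hom = {id}`, `Σ := univ`) satisfies [pGC] Thm A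
(hom form), its isom form, and [Tpcs] Thm 4.12 for every prime — unconditionally, because its
`RelHomGC` / `RelIsomGC` hold tautologically.  Label DEGENERATE: no hyperbolic curve has `Δ = 1`;
instantiated ≠ endorsed. [cite: MochizukiLocAn1999, Thm A p.3] -/
theorem pGC.exists_datum_thmA_and_thmA_isom (K : Type u) [Field K] [CharZero K] :
    ∃ D : RelativeAnabelianDatum (absoluteGaloisGrp K), D.primes = Set.univ ∧
      (∀ X, D.IsHyperbolicCurve X) ∧ pGC.ThmA K D ∧ pGC.ThmA_isom K D ∧
      ∀ (p : ℕ) [Fact p.Prime], Tpcs.Thm_4_12 p K D := by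
  obtain ⟨D, hS, hhyp, hisom, hhom⟩ := RelativeAnabelianDatum.exists_point (absoluteGaloisGrp K)
  exact ⟨D, hS, hhyp, fun _ _ => hhom, fun _ _ => hisom, fun _ _ _ _ => hisom⟩

end Literature.AnabelianGeometry.AbsoluteAnabelian
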